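import Literature.Geometry.Lorentzian.ParametricAnnulusGluing
import Mathlib.Analysis.Calculus.BumpFunction.InnerProduct
import HarnessLib

/-!
# ParametricAnnulusGluing — proofs companion: the squash reparametrisation (step (iv))

Companion of `Literature/Geometry/Lorentzian/ParametricAnnulusGluing.lean`, which vendors the named
fact `ChruscielDelay_parametricAnnulusGluing` (Chruściel–Delay, Mém. SMF 94 (2003), Thm. 5.9,
Prop. 5.10, Cor. 5.11 and §8.6; J. Geom. Phys. 51 (2004), Thm. 6.6; Corvino–Schoen, J. Differential
Geom. 73 (2006), Thm. 2; Chruściel–Isenberg–Pollack, CMP 257 (2005), §§2–4). The docstring of the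
fact assembles it from the printed sources in four steps (i)–(iv). Steps (i)–(iii) — cut-off
interpolation of the family `F c` with `D` on the end, the KID-free weighted-space solution of the
constraint equations on the closed annulus and its extension by zero (Chruściel–Delay 2003,
Thm. 5.9 / Cor. 5.11), and `C^∞` dependence on the parameter (Chruściel–Delay 2004, Thm. 6.6) —
deliver a family `G₀` of vacuum data that is defined and jointly smooth only on a small PARAMETER
BALL `‖c‖ < r`. Step (iv) is elementary and is PROVED here: such a family is turned into a family
on all of `ℝ¹` keeping every clause of the conclusion by the **squash** `ψ c = χ(c) • c`, `χ` a
smooth bump equal to `1` on `‖c‖ ≤ r/2` and supported in `‖c‖ < r`, which is the identity on the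
ball `‖c‖ ≤ r/2` (so `G c = G₀ c = F c` off `e.far R₁` there) and maps ALL of `ℝ¹` into the
parameter ball (so every `G c` is vacuum and equals `D` beyond radius `R₂`).

* §1 `contDiff_bumpSquash`, `norm_bumpSquash_lt`, `bumpSquash_of_norm_le` — the squash;
* §2 `InitialDataSet.exists_smoothDataFamily_of_localGluingFamily` — step (iv) for one datum;
* §3 `ChruscielDelay_parametricAnnulusGluing_of_localFamily` — the fact follows from its own
  statement with the conclusion replaced by the LOCAL, un-squashed family of steps (i)–(iii)
  (hypothesis `H`, stated inline over the same vocabulary; it is the part of the assembly that is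
  not formalised here, and it is NOT asserted).

No new definitions, no new named facts, no axioms (D-0026): this file lowers the fact to its local
core and does not discharge it.

## References

* P. T. Chruściel, E. Delay, Mém. Soc. Math. Fr. 94 (2003), Thm. 5.9, Prop. 5.10, Cor. 5.11, §8.6.
  [ChruscielDelay2003]
* P. T. Chruściel, E. Delay, J. Geom. Phys. 51 (2004), Thm. 6.6. [ChruscielDelay2004]
-/

noncomputable section

open scoped Manifold ContDiff Topology
open Set Filter Bundle Metric

namespace Literature.Geometry.Lorentzian

/-! ## §1 The squash `c ↦ χ(c) • c` by a smooth bump -/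

section Squash

variable {V : Type*} [NormedAddCommGroup V] [InnerProductSpace ℝ V]

/-- The squash `c ↦ χ(c) • c` of a smooth bump `χ` centred at `0` is smooth. [folklore] -/
theorem contDiff_bumpSquash (χ : ContDiffBump (0 : V)) : ContDiff ℝ ∞ (fun c : V ↦ χ c • c) :=
  χ.contDiff.smul contDiff_id

/-- The squash takes values in the open ball of radius `χ.rOut`: inside that ball
`‖χ(c) • c‖ ≤ ‖c‖ < rOut`, outside it `χ(c) = 0`. [folklore] -/
theorem norm_bumpSquash_lt (χ : ContDiffBump (0 : V)) (c : V) : ‖χ c • c‖ < χ.rOut := by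
  by_cases hc : ‖c‖ < χ.rOut
  · calc ‖χ c • c‖ = |χ c| * ‖c‖ := norm_smul _ _
      _ ≤ 1 * ‖c‖ := by
        gcongr
        rw [abs_of_nonneg χ.nonneg]
        exact χ.le_one
      _ = ‖c‖ := one_mul _
      _ < χ.rOut := hc
  · have h0 : χ c = 0 := χ.zero_of_le_dist (by rwa [dist_zero_right, ← not_lt])
    rw [h0, zero_smul, norm_zero]
    exact χ.rOut_pos

/-- The squash is the identity on the closed ball of radius `χ.rIn`. [folklore] -/
theorem bumpSquash_of_norm_le (χ : ContDiffBump (0 : V)) {c : V} (hc : ‖c‖ ≤ χ.rIn) :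
    χ c • c = c := by
  rw [χ.one_of_mem_closedBall (by rwa [mem_closedBall, dist_zero_right]), one_smul]

end Squash

/-! ## §2 Step (iv): from a local family on a parameter ball to the conclusion of the fact -/

section Reduction

variable {X : Type} [TopologicalSpace X] [ChartedSpace E3 X] [IsManifold (𝓡 3) ∞ X]

/-- **Step (iv) of the assembly of `ChruscielDelay_parametricAnnulusGluing`, for one datum.** Let
`G₀ : ℝ¹ → data` be a family through `D = G₀ 0` which, on the parameter ball `‖c‖ < r`, is jointly
smooth in `(c, x)` (both `h` and `k` as maps into the bundle of bilinear forms), solves the vacuum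
constraints, agrees with `F c` at the points not in `A` and with `D` at the points of `B`. Then the
squashed family `G c := G₀ (χ(c) • c)` (`χ` a smooth bump, `= 1` on `‖c‖ ≤ r/2`, supported in
`‖c‖ < r`) is a jointly smooth one-parameter family on all of `ℝ¹`
(`InitialDataSet.IsSmoothDataFamily`) of vacuum data through `D`, equal to `F c` off `A` whenever
`‖c‖ < r/2` (where the squash is the identity) and equal to `D` on `B` for every `c` (the squash
maps into the parameter ball) — the shape of the conclusion of the fact, with `ε = r/2`. [folklore] -/
theorem InitialDataSet.exists_smoothDataFamily_of_localGluingFamily (D : InitialDataSet (𝓡 3) X)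
    (F : EuclideanSpace ℝ (Fin 1) → InitialDataSet (𝓡 3) X) (A B : Set X)
    {r : ℝ} (hr : 0 < r) (G₀ : EuclideanSpace ℝ (Fin 1) → InitialDataSet (𝓡 3) X)
    (hh : ContMDiffOn (𝓘(ℝ, EuclideanSpace ℝ (Fin 1)).prod (𝓡 3))
      ((𝓡 3).prod 𝓘(ℝ, E3 →L[ℝ] E3 →L[ℝ] ℝ)) ∞
      (fun p : EuclideanSpace ℝ (Fin 1) × X ↦
        TotalSpace.mk' (F := E3 →L[ℝ] E3 →L[ℝ] ℝ)
          (E := fun x : X ↦ TangentSpace (𝓡 3) x →L[ℝ] TangentSpace (𝓡 3) x →L[ℝ] ℝ) p.2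
          ((G₀ p.1).h.inner p.2))
      (ball (0 : EuclideanSpace ℝ (Fin 1)) r ×ˢ (univ : Set X)))
    (hk : ContMDiffOn (𝓘(ℝ, EuclideanSpace ℝ (Fin 1)).prod (𝓡 3))
      ((𝓡 3).prod 𝓘(ℝ, E3 →L[ℝ] E3 →L[ℝ] ℝ)) ∞
      (fun p : EuclideanSpace ℝ (Fin 1) × X ↦
        TotalSpace.mk' (F := E3 →L[ℝ] E3 →L[ℝ] ℝ)
          (E := fun x : X ↦ TangentSpace (𝓡 3) x →L[ℝ] TangentSpace (𝓡 3) x →L[ℝ] ℝ) p.2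
          ((G₀ p.1).k p.2))
      (ball (0 : EuclideanSpace ℝ (Fin 1)) r ×ˢ (univ : Set X)))
    (h0 : G₀ 0 = D)
    (hvac : ∀ c : EuclideanSpace ℝ (Fin 1), ‖c‖ < r →
      ∀ [(G₀ c).metric.HasLeviCivita], (G₀ c).IsVacuumConstraintSolution)
    (hin : ∀ c : EuclideanSpace ℝ (Fin 1), ‖c‖ < r → ∀ x ∉ A,
      (G₀ c).h.inner x = (F c).h.inner x ∧ (G₀ c).k x = (F c).k x)
    (hout : ∀ c : EuclideanSpace ℝ (Fin 1), ‖c‖ < r → ∀ x ∈ B,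
      (G₀ c).h.inner x = D.h.inner x ∧ (G₀ c).k x = D.k x) :
    ∃ (G : EuclideanSpace ℝ (Fin 1) → InitialDataSet (𝓡 3) X) (ε : ℝ), 0 < ε ∧
      InitialDataSet.IsSmoothDataFamily 1 G ∧ G 0 = D ∧
      (∀ c, ∀ [(G c).metric.HasLeviCivita], (G c).IsVacuumConstraintSolution) ∧
      (∀ c, ‖c‖ < ε → ∀ x ∉ A, (G c).h.inner x = (F c).h.inner x ∧ (G c).k x = (F c).k x) ∧
      (∀ c, ∀ x ∈ B, (G c).h.inner x = D.h.inner x ∧ (G c).k x = D.k x) := by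
  -- the bump: `= 1` on `‖c‖ ≤ r/2`, supported in `‖c‖ < r`
  let χ : ContDiffBump (0 : EuclideanSpace ℝ (Fin 1)) := ⟨r / 2, r, by positivity, by linarith⟩
  have hball : ∀ c : EuclideanSpace ℝ (Fin 1), ‖χ c • c‖ < r := fun c ↦ norm_bumpSquash_lt χ c
  refine ⟨fun c ↦ G₀ (χ c • c), r / 2, by positivity, ?_, ?_, ?_, ?_, ?_⟩
  · -- joint smoothness on all of `ℝ¹ × X`: compose with the smooth squash, which maps into the ball
    have hσ : ContMDiff 𝓘(ℝ, EuclideanSpace ℝ (Fin 1)) 𝓘(ℝ, EuclideanSpace ℝ (Fin 1)) ∞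
        (fun c : EuclideanSpace ℝ (Fin 1) ↦ χ c • c) :=
      (contDiff_bumpSquash χ).contMDiff
    have hmap : ContMDiff (𝓘(ℝ, EuclideanSpace ℝ (Fin 1)).prod (𝓡 3))
        (𝓘(ℝ, EuclideanSpace ℝ (Fin 1)).prod (𝓡 3)) ∞
        (fun p : EuclideanSpace ℝ (Fin 1) × X ↦ (χ p.1 • p.1, p.2)) :=
      (hσ.comp contMDiff_fst).prodMk contMDiff_snd
    have hmem : ∀ p : EuclideanSpace ℝ (Fin 1) × X,
        (χ p.1 • p.1, p.2) ∈ ball (0 : EuclideanSpace ℝ (Fin 1)) r ×ˢ (univ : Set X) :=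
      fun p ↦ ⟨mem_ball_zero_iff.2 (hball p.1), mem_univ _⟩
    exact ⟨hh.comp_contMDiff hmap hmem, hk.comp_contMDiff hmap hmem⟩
  · show G₀ (χ 0 • (0 : EuclideanSpace ℝ (Fin 1))) = D
    rw [smul_zero]
    exact h0
  · intro c
    exact hvac _ (hball c)
  · intro c hc x hx
    have hψ : χ c • c = c := bumpSquash_of_norm_le χ hc.le
    show (G₀ (χ c • c)).h.inner x = (F c).h.inner x ∧ (G₀ (χ c • c)).k x = (F c).k x
    rw [hψ]
    exact hin c (by linarith) x hx
  · intro c x hx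
    exact hout _ (hball c) x hx

end Reduction

/-! ## §3 The fact from its local, un-squashed core -/

/-- **`ChruscielDelay_parametricAnnulusGluing` reduces to its local, un-squashed core.** The
hypothesis `H` is the fact with the SAME data, family, radii, vacuum and KID-freeness hypotheses
(verbatim) and with the conclusion replaced by what steps (i)–(iii) of the printed assembly
deliver: a family `G₀` through `D`, defined on `ℝ¹` but controlled only on a parameter ball
`‖c‖ < r` — jointly smooth there, vacuum there, equal to `F c` off `e.far R₁` and to `D` on
`e.far R₂` there (Chruściel–Delay 2003, Thm. 5.9 with Prop. 5.10 and Cor. 5.11 on the closed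
annulus, whose kernel `𝒦₀` is trivial by the KID hypothesis, and §8.6, pp. 52–54: "`(K, g)` belongs
to a one-parameter family of solutions `(K_λ, g_λ)` … converging to `(K₀|_M, g₀|_M)` … one obtains
an extension for `λ` small enough when `P*` has no kernel"; Chruściel–Delay 2004, Thm. 6.6 for the
`C^∞` dependence on the parameter). From `H` the fact follows by step (iv),
`InitialDataSet.exists_smoothDataFamily_of_localGluingFamily`. `H` is NOT proved in the tree
(weighted elliptic theory for `L = P Φ² ψ² P*`, Banach inverse function theorem into `C^∞`); this
theorem only records that nothing beyond it is needed.
[cite: ChruscielDelay2003, Thm. 5.9, Prop. 5.10, Cor. 5.11 and §8.6] -/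
theorem ChruscielDelay_parametricAnnulusGluing_of_localFamily
    (H : ∀ (X : Type) [TopologicalSpace X] [ChartedSpace E3 X] [IsManifold (𝓡 3) ∞ X]
      [T2Space X] [SecondCountableTopology X] [ConnectedSpace X]
      (e : AFEnd X) (D : InitialDataSet (𝓡 3) X)
      (F : EuclideanSpace ℝ (Fin 1) → InitialDataSet (𝓡 3) X) (R₁ R₂ : ℝ),
      (∀ [D.metric.HasLeviCivita], D.IsVacuumConstraintSolution) →
      InitialDataSet.IsSmoothDataFamily 1 F → F 0 = D →
      (∀ c, ∀ [(F c).metric.HasLeviCivita], (F c).IsVacuumConstraintSolution) →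
      e.R ≤ R₁ → R₁ < R₂ →
      (¬ ∃ (N : E3 → ℝ) (Y : E3 → E3),
          ContDiffOn ℝ ∞ N {y : E3 | R₁ < ‖y‖ ∧ ‖y‖ < R₂} ∧
          ContDiffOn ℝ ∞ Y {y : E3 | R₁ < ‖y‖ ∧ ‖y‖ < R₂} ∧
          (∃ y : E3, R₁ < ‖y‖ ∧ ‖y‖ < R₂ ∧ (N y ≠ 0 ∨ Y y ≠ 0)) ∧
          ∀ y : E3, R₁ < ‖y‖ → ‖y‖ < R₂ →
            MetricCoord.adjHamG (e.hCoeff D) (e.kCoeff D) N y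
                + MetricCoord.adjMomGS (e.hCoeff D) (e.kCoeff D) Y y = 0 ∧
              MetricCoord.adjHamK (e.hCoeff D) (e.kCoeff D) N y
                + MetricCoord.adjMomKS (e.hCoeff D) Y y = 0) →
      ∃ (r : ℝ) (G₀ : EuclideanSpace ℝ (Fin 1) → InitialDataSet (𝓡 3) X), 0 < r ∧
        ContMDiffOn (𝓘(ℝ, EuclideanSpace ℝ (Fin 1)).prod (𝓡 3))
          ((𝓡 3).prod 𝓘(ℝ, E3 →L[ℝ] E3 →L[ℝ] ℝ)) ∞
          (fun p : EuclideanSpace ℝ (Fin 1) × X ↦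
            TotalSpace.mk' (F := E3 →L[ℝ] E3 →L[ℝ] ℝ)
              (E := fun x : X ↦ TangentSpace (𝓡 3) x →L[ℝ] TangentSpace (𝓡 3) x →L[ℝ] ℝ)
              p.2 ((G₀ p.1).h.inner p.2))
          (ball (0 : EuclideanSpace ℝ (Fin 1)) r ×ˢ (univ : Set X)) ∧
        ContMDiffOn (𝓘(ℝ, EuclideanSpace ℝ (Fin 1)).prod (𝓡 3))
          ((𝓡 3).prod 𝓘(ℝ, E3 →L[ℝ] E3 →L[ℝ] ℝ)) ∞
          (fun p : EuclideanSpace ℝ (Fin 1) × X ↦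
            TotalSpace.mk' (F := E3 →L[ℝ] E3 →L[ℝ] ℝ)
              (E := fun x : X ↦ TangentSpace (𝓡 3) x →L[ℝ] TangentSpace (𝓡 3) x →L[ℝ] ℝ)
              p.2 ((G₀ p.1).k p.2))
          (ball (0 : EuclideanSpace ℝ (Fin 1)) r ×ˢ (univ : Set X)) ∧
        G₀ 0 = D ∧
        (∀ c : EuclideanSpace ℝ (Fin 1), ‖c‖ < r →
          ∀ [(G₀ c).metric.HasLeviCivita], (G₀ c).IsVacuumConstraintSolution) ∧
        (∀ c : EuclideanSpace ℝ (Fin 1), ‖c‖ < r → ∀ x ∉ e.far R₁,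
          (G₀ c).h.inner x = (F c).h.inner x ∧ (G₀ c).k x = (F c).k x) ∧
        (∀ c : EuclideanSpace ℝ (Fin 1), ‖c‖ < r → ∀ x ∈ e.far R₂,
          (G₀ c).h.inner x = D.h.inner x ∧ (G₀ c).k x = D.k x)) :
    ChruscielDelay_parametricAnnulusGluing := by
  intro X _ _ _ _ _ _ e D F R₁ R₂ hvac hF hF0 hFvac hR₁ hR₁₂ hKID
  obtain ⟨r, G₀, hr, hh, hk, h0, hvac', hin, hout⟩ :=
    H X e D F R₁ R₂ hvac hF hF0 hFvac hR₁ hR₁₂ hKID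
  exact D.exists_smoothDataFamily_of_localGluingFamily F (e.far R₁) (e.far R₂) hr G₀ hh hk h0
    hvac' hin hout

end Literature.Geometry.Lorentzian

end
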